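import Summits.CriticalPhenomena.SAWScalingLimit.Theses.SAWDefectDecoherence
import Literature.Probability.LatticeModels.TriangularLatticeProofs

/-!
# Crux `SAWDefectDecoherence.MassRatio` (stmt-CriticalPhenomena-8550) — line `coherence-floor-rh-harnack`

Skeleton (crux-plan, round 1) for the crux idea card
`Cruxes/MassRatio/Ideas/coherence-floor-rh-harnack.md` (triage r1: 3 × pass).

**Idea.** `MassRatio` compares two POSITIVE masses of the critical hexagonal SAW from the root
`a_δ`: the bulk mass `δ² Σ_{e ∈ K} Z_δ(e)` and the boundary point mass `Z_δ(b_δ)`, at the exponent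
cut `δ^{-3/4}` (predicted ratio `δ^{-25/48}`, slack `11/48`). The card factors the comparison
through the spin-`5/8` observable `F_δ` (`|F_δ| ≤ Z_δ` pointwise, `|F_δ(b_δ)| = Z_δ(b_δ)`):

* `stub_signalCoherenceL1` — the **coherence floor** (the lever), summed over the vertex stars deep in a
  compact `K ⊂ Ω`: `c · δ^{θ'} · Σ_v Σ_{t ∼ v} Z_δ(vt) ≤ Σ_v |Σ_{t ∼ v} F_δ(vt)|` eventually, for SOME
  `θ' < 3/4` (predicted `θ' = h_b − x₁ = 25/48`), with a constant depending on the domain data and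
  `K` (the universal-constant form is not claimed);
* `stub_localL1Bound` — the **local `L¹` bound** (the route's foreseen node `LocalL1Bound` of
  `BoundaryClosure`, here with an arbitrarily small power loss `δ^{-s}`, every `s > 0`):
  `δ² Σ_{e ∈ K} |F_δ(e)| ≤ C δ^{-s} |F_δ(b_δ)|` eventually.

**Proved here (no `sorry`; axioms `propext`, `Classical.choice`, `Quot.sound`).**
* `massRatioAt_of` — the card's First lemma / Transfer `C⁺ ⟹ crux` at a GENERAL cut:
  `θ' + s ≤ c`, `SignalCoherence θ'`, `LocalL1Bound s` ⟹ `MassRatioAt c` (group the `K`-edges by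
  endpoint stars with centres in `K₁ = cthickening d K`, apply the floor, `‖Σ F‖ ≤ Σ ‖F‖`, each edge
  lies in at most two stars, apply the `L¹` bound on `K₂ = cthickening d K₁`, and
  `|F_δ(b_δ)| ≤ Z_δ(b_δ)` by `norm_hexParafermionicObservable_le` + `hexParafermionicObservable_zero_spin`;
  exhaustion puts all these stars inside `Λ_δ` eventually). The exponent budget is the only
  arithmetic: `δ^{-θ'} · δ^{-s} ≤ δ^{-c}` for `δ ≤ 1`.
* `MassRatio_of : SAWDefectDecoherence.MassRatio` — the composition at the filed cut `c = 3/4`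
  (`θ' < 3/4` from stub 1, `s := 3/4 − θ' > 0` into stub 2).
* lattice helpers: `norm_hexCenter_sub_le_one` (adjacent face centres are at distance `≤ 1`, in
  fact `1/√3`), `finite_setOf_adj`, `hexDomainMidEdges_finite`.

**Disproof used** (cdisprove `Disproof.lean` v3, known through its evidence notes on the item; the
file is not mounted in planner jails): `massRatio_false_without_rows` — the rows clause at `b` is
load-bearing; in this line `b_δ` enters ONLY through the normalisation `|F_δ(b_δ)|` of
`stub_localL1Bound`, which therefore carries (and must use) the rows clause — the same root-side
bare-fjord family `HexNav.LamF` that refutes `MassRatioWithoutRows` starves `F_δ(b_δ)` and refutes the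
rows-free `L¹` bound; `stub_signalCoherence` does not mention `b_δ` at all. `corridor_transfer`
(a bare corridor at the root is an exact common factor): both stubs are homogeneous of degree one in
the walk weights from `a_δ` (floor: `F⋆` and `Z⋆` pick up the same factor `x^N` and one common
phase; `L¹` bound: both sides scale by `x^N`), consistent. `HexNav.massRatio_frame_nonvacuous`: the
common hypothesis frame of both stubs is the crux's frame verbatim, hence satisfiable. No `Negative/`
lemma has landed for this crux (nothing to import).

**Reshape (line lead, 2026-08-16).** Stub 1 is now `stub_signalCoherenceL1`, the `K`-SUMMED
coherence floor `c δ^{θ'} Σ_{v : δc_v ∈ K} Σ⋆Z_δ(v) ≤ Σ_{v : δc_v ∈ K} |Σ⋆F_δ(v)|` — strictly weaker than the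
round-1 pointwise floor (`signalCoherenceL1_of_pointwise`), and exactly what the glue consumes
(`massRatioAt_of` sums the floor over the stars anyway); the pointwise predicate `SignalCoherence` is
kept as a sufficient condition (`massRatioAt_of_pointwise`, `relativeDefect_of_decoherence_of_floor`).
Rationale: the composition never needs the floor at an individual star, and a pointwise floor could
fail at exceptional lattice stars (local near-cancellations) without affecting the crux; the summed
form is immune to isolated destructive interference. Both registered stubs remain OPEN PROBLEMS of the
same class as the crux (wave 1: `stub_localL1Bound` → `stub-blocked: none`, no interior control of
`F_{5/8}` by its boundary modulus exists in tree or print; lead: no rigorous lower bound on the winding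
characteristic function of boundary-to-bulk critical SAW exists).

**Reshape 2 (line lead gen 1, 2026-08-16).** Stub 2 is now `stub_localL1BoundZ`: the same local `L¹`
bound but normalised by the boundary MASS `Z_δ(b_δ) = ‖F_{x_c,0}(b_δ)‖` rather than by `|F_{x_c,5/8}(b_δ)|`
— strictly weaker (`localL1BoundZ_of_localL1Bound`, via `|F_σ| ≤ F_0`), independent of boundary winding
rigidity (support stmt-8515), and exactly the quantity `massRatioAt_of` consumes (its former step (4)
`|F_δ(b_δ)| ≤ Z_δ(b_δ)` is gone). The round-1 predicates `SignalCoherence`, `LocalL1Bound` survive as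
sufficient conditions (`massRatioAt_of_pointwise`, `massRatioAt_of_localL1Bound`).

**Route status at filing.** The route went BROKEN at 2026-08-15T23:46Z (target `HexObservableLimit`
refuted-misstated by `Theorems/SAWDefectDecoherenceHexObservableLimitRefutation.lean`: a boundary-hugging
corridor at the ROOT relocates the conformally effective root). That witness is invisible here: a root
corridor is an exact common factor of `F⋆`, `Z⋆`, `Σ_K |F_δ|` and `|F_δ(b_δ)|` (`corridor_transfer`), and
no conformal map enters this line; if `MassRatio` is restated over the repaired (stronger) frame, both
stubs weaken verbatim with it and `massRatioAt_of` goes through unchanged.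
-/

namespace Summit.CriticalPhenomena.SAWScalingLimit.Cruxes.MassRatio.CoherenceFloorRhHarnack

open Literature.Probability.RandomPlanarGeometry Literature.Probability.RandomPlanarGeometry.SAW
open Literature.Probability.LatticeModels
open Summit.CriticalPhenomena.SAWScalingLimit.Theses.SAWDefectDecoherence

/-! ## Stubs (registered; `sorry` only here) -/

/-- **Stub 1 (reshaped 2026-08-16) — `K`-summed coherence floor of the signal at vertex stars (the
lever; hardest).** In the frame of `MassRatio` (Dobrushin domain flat near `b`, admissible family `Λ_δ`
with the rows clause at `b`, exhaustion of compacts, `δ·a_δ → a`, `δ·b_δ → b`): there is an exponent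
`θ' < 3/4` such that for every compact `K ⊆ Ω` some `c > 0` satisfies, eventually as `δ → 0+`,
`c · δ^{θ'} · Σ_{v ∈ Λ_δ, δ·c_v ∈ K} Σ_{t ∈ Λ_δ, t ∼ v} Z_δ({v,t}) ≤ Σ_{v ∈ Λ_δ, δ·c_v ∈ K} |Σ_{t ∈ Λ_δ, t ∼ v} F_δ({v,t})|`
(`Z_δ = F_{x_c,0}`, `F_δ = F_{x_c,5/8}` from the root `a_δ`; the outer sums are `finsum`s over a subset
of the finite set `Λ_δ`). This is the round-1 pointwise floor summed over the `K`-stars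
(`signalCoherenceL1_of_pointwise`) and is all the glue `massRatioAt_of` uses. Dictionary: an `L¹(K)`
lower bound `‖μ̂_·(5/8)‖_{L¹} ≥ c R^{-θ'} ‖μ̂_·(0)‖_{L¹}` for the positive final-direction laws `μ_v` at
depth `R ≍ 1/δ`. Why plausibly true: modulo DCS Conjecture 2 it is EQUIVALENT to the `K`-averaged
mass ratio at exponent `θ'`, predicted `25/48 = h_b − x₁` with `11/48` to spare (sibling numerics on
stmt-8549: `|S₀|/M ∝ R^{-0.53}` at `R ≤ 8`). Status: OPEN — no rigorous lower bound on the winding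
characteristic function `|Σ_γ x_c^ℓ e^{-i(5/8)W(γ)}| / Σ_γ x_c^ℓ` of boundary-to-bulk critical SAW
exists (the VR consequences `F_t = (S₀ + d_t S₂)/3` only trade the star floor for a per-edge floor;
barrier `ParafermionicHalfCauchyRiemann`: no linear-relation route). Size XL / open. Leans on:
`hexParafermionicObservable`, `DuminilCopinSmirnov2012_lemma1_holds` (VR, proved),
`SpinShift`/`StaggeredSumRule` (supports), the definition request `HexSAWScreenSkeleton`. -/
theorem stub_signalCoherenceL1 :
    ∃ θ' : ℝ, θ' < 3 / 4 ∧
      ∀ (D : DobrushinDomain) (ρ : ℝ) (Λ : ℝ → Finset HexVertex) (m : ℝ → ℤ)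
        (a b : ℝ → Sym2 HexVertex),
        0 < ρ →
        D.carrier ∩ Metric.ball (D.pt 1) ρ = {z : ℂ | (D.pt 1).im < z.im} ∩ Metric.ball (D.pt 1) ρ →
        (∀ᶠ δ : ℝ in nhdsWithin 0 (Set.Ioi 0),
          hexDomainSimplyConnected (Λ δ) ∧ a δ ∈ hexDomainBoundary (Λ δ) ∧
            b δ ∈ hexDomainBoundary (Λ δ) ∧ Nonempty (HexMidEdgeSAW (Λ δ) (a δ) (b δ)) ∧
            (hexGraph.induce ((Λ δ : Finset HexVertex) : Set HexVertex)).Preconnected ∧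
            (∀ v ∈ Λ δ, (δ : ℂ) * hexCenter v ∈ D.carrier) ∧
            (∀ v : HexVertex, (δ : ℂ) * hexCenter v ∈ Metric.ball (D.pt 1) ρ →
              (v ∈ Λ δ ↔ m δ ≤ v.1 1))) →
        (∀ K : Set ℂ, IsCompact K → K ⊆ D.carrier → ∀ᶠ δ : ℝ in nhdsWithin 0 (Set.Ioi 0),
          ∀ v : HexVertex, (δ : ℂ) * hexCenter v ∈ K → v ∈ Λ δ) →
        Filter.Tendsto (fun δ : ℝ => (δ : ℂ) * hexMidpoint (a δ)) (nhdsWithin 0 (Set.Ioi 0))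
          (nhds (D.pt 0)) →
        Filter.Tendsto (fun δ : ℝ => (δ : ℂ) * hexMidpoint (b δ)) (nhdsWithin 0 (Set.Ioi 0))
          (nhds (D.pt 1)) →
        ∀ K : Set ℂ, IsCompact K → K ⊆ D.carrier → ∃ c : ℝ, 0 < c ∧
          ∀ᶠ δ : ℝ in nhdsWithin 0 (Set.Ioi 0),
            c * δ ^ θ' * (∑ᶠ v ∈ {v : HexVertex | v ∈ Λ δ ∧ (δ : ℂ) * hexCenter v ∈ K},
                ∑ t ∈ (Λ δ).filter (fun t => hexGraph.Adj v t),
                  ‖hexParafermionicObservable (Λ δ) (a δ) hexCriticalFugacity 0 s(v, t)‖) ≤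
              ∑ᶠ v ∈ {v : HexVertex | v ∈ Λ δ ∧ (δ : ℂ) * hexCenter v ∈ K},
                ‖∑ t ∈ (Λ δ).filter (fun t => hexGraph.Adj v t),
                  hexParafermionicObservable (Λ δ) (a δ) hexCriticalFugacity (5 / 8) s(v, t)‖ := by
  sorry

/-- **Stub 2 (reshaped 2026-08-16, lead gen 1: normalised by the boundary MASS `Z_δ(b_δ) = F_{x_c,0}(b_δ)`
instead of `|F_{x_c,5/8}(b_δ)|`; strictly weaker than the round-1 form since `|F_{5/8}(b_δ)| ≤ Z_δ(b_δ)`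
(`localL1BoundZ_of_localL1Bound`), equivalent to it under boundary winding rigidity (support stmt-8515, not
assumed here), and exactly what the glue consumes) — local `L¹` bound for the spin-`5/8` observable,
normalised at `b_δ` (the route's foreseen node `LocalL1Bound` of `BoundaryClosure`, with an arbitrarily
small power loss).**
In the frame of `MassRatio`: for every `s > 0` and every compact `K ⊆ Ω` there is `C` with
`δ² Σ_{e : δ·mid e ∈ K} |F_δ(e)| ≤ C δ^{-s} Z_δ(b_δ)` eventually as `δ → 0+` (`Z_δ = F_{x_c,0} = Σ_γ x_c^ℓ`).
This is where `b_δ` — hence the rows clause at `b` (cdisprove: `massRatio_false_without_rows`) —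
enters the line. Why plausibly true: Conjecture 2 predicts `F_δ(e)/F_δ(b_δ) → f(δ·mid e)` locally
uniformly, so the bound holds with `s = 0`; `s > 0` is slack. Mechanism: OPEN — the card's
comparison-field completion (discrete Riemann–Hilbert solution `S` with `VR + zero circulation +
argument condition`) is not determined (triage r1-3: `dim ker = E_∂ − 2` at every size; the boundary
MODULUS is free), so a proof must couple the holomorphic information (VR, small conjugate defects) to
the positive boundary modulus `|F_δ| = Z_δ` on `∂Λ_δ`; a phase-blind Cauchy estimate from `L¹`
boundary data loses `δ^{-1/4}` at the root (`s = 1/4`, the quarter law), which fits only after a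
re-cut of the crux to `c ≥ 37/48 + ε` (`massRatioAt_of` is stated for every cut). Size XL / open.
Leans on: `DuminilCopinSmirnov2012_lemma1_holds`, `BoundaryWindingRigidity`, `StaggeredSumRule`,
`HexGreen.sum_relations_eq_hexFlux`, `hexCirculation`; Chelkak–Smirnov discrete complex analysis
(arXiv:0810.2188), Smirnov ICM 2010 §3 (arXiv:1009.6077). -/
theorem stub_localL1BoundZ :
    ∀ s : ℝ, 0 < s →
      ∀ (D : DobrushinDomain) (ρ : ℝ) (Λ : ℝ → Finset HexVertex) (m : ℝ → ℤ)
        (a b : ℝ → Sym2 HexVertex),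
        0 < ρ →
        D.carrier ∩ Metric.ball (D.pt 1) ρ = {z : ℂ | (D.pt 1).im < z.im} ∩ Metric.ball (D.pt 1) ρ →
        (∀ᶠ δ : ℝ in nhdsWithin 0 (Set.Ioi 0),
          hexDomainSimplyConnected (Λ δ) ∧ a δ ∈ hexDomainBoundary (Λ δ) ∧
            b δ ∈ hexDomainBoundary (Λ δ) ∧ Nonempty (HexMidEdgeSAW (Λ δ) (a δ) (b δ)) ∧
            (hexGraph.induce ((Λ δ : Finset HexVertex) : Set HexVertex)).Preconnected ∧
            (∀ v ∈ Λ δ, (δ : ℂ) * hexCenter v ∈ D.carrier) ∧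
            (∀ v : HexVertex, (δ : ℂ) * hexCenter v ∈ Metric.ball (D.pt 1) ρ →
              (v ∈ Λ δ ↔ m δ ≤ v.1 1))) →
        (∀ K : Set ℂ, IsCompact K → K ⊆ D.carrier → ∀ᶠ δ : ℝ in nhdsWithin 0 (Set.Ioi 0),
          ∀ v : HexVertex, (δ : ℂ) * hexCenter v ∈ K → v ∈ Λ δ) →
        Filter.Tendsto (fun δ : ℝ => (δ : ℂ) * hexMidpoint (a δ)) (nhdsWithin 0 (Set.Ioi 0))
          (nhds (D.pt 0)) →
        Filter.Tendsto (fun δ : ℝ => (δ : ℂ) * hexMidpoint (b δ)) (nhdsWithin 0 (Set.Ioi 0))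
          (nhds (D.pt 1)) →
        ∀ K : Set ℂ, IsCompact K → K ⊆ D.carrier → ∃ C : ℝ,
          ∀ᶠ δ : ℝ in nhdsWithin 0 (Set.Ioi 0),
            δ ^ 2 * (∑ᶠ e ∈ {e : Sym2 HexVertex | e ∈ hexDomainMidEdges (Λ δ) ∧
                (δ : ℂ) * hexMidpoint e ∈ K},
                ‖hexParafermionicObservable (Λ δ) (a δ) hexCriticalFugacity (5 / 8) e‖) ≤
              C * δ ^ (-s) *
                ‖hexParafermionicObservable (Λ δ) (a δ) hexCriticalFugacity 0 (b δ)‖ := by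
  sorry

/-! ## The two stub statements as predicates in the exponent, and the crux at a general cut -/

/-- `SignalCoherence θ'`: the coherence floor with exponent `θ'` (stub 1 is `∃ θ' < 3/4,
SignalCoherence θ'`). -/
def SignalCoherence (θ' : ℝ) : Prop :=
  ∀ (D : DobrushinDomain) (ρ : ℝ) (Λ : ℝ → Finset HexVertex) (m : ℝ → ℤ)
    (a b : ℝ → Sym2 HexVertex),
    0 < ρ →
    D.carrier ∩ Metric.ball (D.pt 1) ρ = {z : ℂ | (D.pt 1).im < z.im} ∩ Metric.ball (D.pt 1) ρ →
    (∀ᶠ δ : ℝ in nhdsWithin 0 (Set.Ioi 0),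
      hexDomainSimplyConnected (Λ δ) ∧ a δ ∈ hexDomainBoundary (Λ δ) ∧
        b δ ∈ hexDomainBoundary (Λ δ) ∧ Nonempty (HexMidEdgeSAW (Λ δ) (a δ) (b δ)) ∧
        (hexGraph.induce ((Λ δ : Finset HexVertex) : Set HexVertex)).Preconnected ∧
        (∀ v ∈ Λ δ, (δ : ℂ) * hexCenter v ∈ D.carrier) ∧
        (∀ v : HexVertex, (δ : ℂ) * hexCenter v ∈ Metric.ball (D.pt 1) ρ →
          (v ∈ Λ δ ↔ m δ ≤ v.1 1))) →
    (∀ K : Set ℂ, IsCompact K → K ⊆ D.carrier → ∀ᶠ δ : ℝ in nhdsWithin 0 (Set.Ioi 0),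
      ∀ v : HexVertex, (δ : ℂ) * hexCenter v ∈ K → v ∈ Λ δ) →
    Filter.Tendsto (fun δ : ℝ => (δ : ℂ) * hexMidpoint (a δ)) (nhdsWithin 0 (Set.Ioi 0))
      (nhds (D.pt 0)) →
    Filter.Tendsto (fun δ : ℝ => (δ : ℂ) * hexMidpoint (b δ)) (nhdsWithin 0 (Set.Ioi 0))
      (nhds (D.pt 1)) →
    ∀ K : Set ℂ, IsCompact K → K ⊆ D.carrier → ∃ c : ℝ, 0 < c ∧
      ∀ᶠ δ : ℝ in nhdsWithin 0 (Set.Ioi 0), ∀ v : HexVertex, (δ : ℂ) * hexCenter v ∈ K →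
        c * δ ^ θ' * (∑ t ∈ (Λ δ).filter (fun t => hexGraph.Adj v t),
            ‖hexParafermionicObservable (Λ δ) (a δ) hexCriticalFugacity 0 s(v, t)‖) ≤
          ‖∑ t ∈ (Λ δ).filter (fun t => hexGraph.Adj v t),
            hexParafermionicObservable (Λ δ) (a δ) hexCriticalFugacity (5 / 8) s(v, t)‖

/-- `SignalCoherenceL1 θ'`: the `K`-summed coherence floor with exponent `θ'` (stub 1 is
`∃ θ' < 3/4, SignalCoherenceL1 θ'`); the outer sums run over `{v ∈ Λ_δ | δ·c_v ∈ K}` as `finsum`s. -/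
def SignalCoherenceL1 (θ' : ℝ) : Prop :=
  ∀ (D : DobrushinDomain) (ρ : ℝ) (Λ : ℝ → Finset HexVertex) (m : ℝ → ℤ)
    (a b : ℝ → Sym2 HexVertex),
    0 < ρ →
    D.carrier ∩ Metric.ball (D.pt 1) ρ = {z : ℂ | (D.pt 1).im < z.im} ∩ Metric.ball (D.pt 1) ρ →
    (∀ᶠ δ : ℝ in nhdsWithin 0 (Set.Ioi 0),
      hexDomainSimplyConnected (Λ δ) ∧ a δ ∈ hexDomainBoundary (Λ δ) ∧
        b δ ∈ hexDomainBoundary (Λ δ) ∧ Nonempty (HexMidEdgeSAW (Λ δ) (a δ) (b δ)) ∧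
        (hexGraph.induce ((Λ δ : Finset HexVertex) : Set HexVertex)).Preconnected ∧
        (∀ v ∈ Λ δ, (δ : ℂ) * hexCenter v ∈ D.carrier) ∧
        (∀ v : HexVertex, (δ : ℂ) * hexCenter v ∈ Metric.ball (D.pt 1) ρ →
          (v ∈ Λ δ ↔ m δ ≤ v.1 1))) →
    (∀ K : Set ℂ, IsCompact K → K ⊆ D.carrier → ∀ᶠ δ : ℝ in nhdsWithin 0 (Set.Ioi 0),
      ∀ v : HexVertex, (δ : ℂ) * hexCenter v ∈ K → v ∈ Λ δ) →
    Filter.Tendsto (fun δ : ℝ => (δ : ℂ) * hexMidpoint (a δ)) (nhdsWithin 0 (Set.Ioi 0))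
      (nhds (D.pt 0)) →
    Filter.Tendsto (fun δ : ℝ => (δ : ℂ) * hexMidpoint (b δ)) (nhdsWithin 0 (Set.Ioi 0))
      (nhds (D.pt 1)) →
    ∀ K : Set ℂ, IsCompact K → K ⊆ D.carrier → ∃ c : ℝ, 0 < c ∧
      ∀ᶠ δ : ℝ in nhdsWithin 0 (Set.Ioi 0),
        c * δ ^ θ' * (∑ᶠ v ∈ {v : HexVertex | v ∈ Λ δ ∧ (δ : ℂ) * hexCenter v ∈ K},
            ∑ t ∈ (Λ δ).filter (fun t => hexGraph.Adj v t),
              ‖hexParafermionicObservable (Λ δ) (a δ) hexCriticalFugacity 0 s(v, t)‖) ≤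
          ∑ᶠ v ∈ {v : HexVertex | v ∈ Λ δ ∧ (δ : ℂ) * hexCenter v ∈ K},
            ‖∑ t ∈ (Λ δ).filter (fun t => hexGraph.Adj v t),
              hexParafermionicObservable (Λ δ) (a δ) hexCriticalFugacity (5 / 8) s(v, t)‖

/-- The vertices of `Λ_δ` with centre in `K` form a finite set (a subset of `Λ_δ`). -/
theorem finite_setOf_mem_center {Λ' : Finset HexVertex} {δ : ℝ} {K : Set ℂ} :
    {v : HexVertex | v ∈ Λ' ∧ (δ : ℂ) * hexCenter v ∈ K}.Finite :=
  Λ'.finite_toSet.subset fun _ hv => hv.1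

/-- The `finsum` over `{v ∈ Λ' | δ·c_v ∈ K}` (elaborated as a conditional `finsum`) is the `Finset`
sum over the corresponding finite set. -/
theorem finsum_center_eq_sum {Λ' : Finset HexVertex} {δ : ℝ} {K : Set ℂ} (f : HexVertex → ℝ) :
    ∑ᶠ (v : HexVertex) (_ : v ∈ Λ' ∧ (δ : ℂ) * hexCenter v ∈ K), f v =
      ∑ v ∈ (finite_setOf_mem_center (Λ' := Λ') (δ := δ) (K := K)).toFinset, f v :=
  finsum_cond_eq_sum_of_cond_iff f (fun {v} _ => by rw [Set.Finite.mem_toFinset]; rfl)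

/-- **The pointwise floor implies the summed floor** (sum the star inequality over the `K`-stars). -/
theorem signalCoherenceL1_of_pointwise {θ' : ℝ} (h : SignalCoherence θ') : SignalCoherenceL1 θ' := by
  intro D ρ Λ m a b hρ hflat hadm hexh ha hb K hK hKD
  obtain ⟨c, hc, hfl⟩ := h D ρ Λ m a b hρ hflat hadm hexh ha hb K hK hKD
  refine ⟨c, hc, ?_⟩
  filter_upwards [hfl] with δ hδ
  have hS := (finite_setOf_mem_center (Λ' := Λ δ) (δ := δ) (K := K))
  rw [finsum_center_eq_sum, finsum_center_eq_sum, Finset.mul_sum]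
  exact Finset.sum_le_sum fun v hv => hδ v (hS.mem_toFinset.1 hv).2

/-- `LocalL1Bound s`: the local `L¹` bound with power loss `δ^{-s}` (stub 2 is `∀ s > 0,
LocalL1Bound s`; the route's foreseen node is `LocalL1Bound 0`). -/
def LocalL1Bound (s : ℝ) : Prop :=
  ∀ (D : DobrushinDomain) (ρ : ℝ) (Λ : ℝ → Finset HexVertex) (m : ℝ → ℤ)
    (a b : ℝ → Sym2 HexVertex),
    0 < ρ →
    D.carrier ∩ Metric.ball (D.pt 1) ρ = {z : ℂ | (D.pt 1).im < z.im} ∩ Metric.ball (D.pt 1) ρ →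
    (∀ᶠ δ : ℝ in nhdsWithin 0 (Set.Ioi 0),
      hexDomainSimplyConnected (Λ δ) ∧ a δ ∈ hexDomainBoundary (Λ δ) ∧
        b δ ∈ hexDomainBoundary (Λ δ) ∧ Nonempty (HexMidEdgeSAW (Λ δ) (a δ) (b δ)) ∧
        (hexGraph.induce ((Λ δ : Finset HexVertex) : Set HexVertex)).Preconnected ∧
        (∀ v ∈ Λ δ, (δ : ℂ) * hexCenter v ∈ D.carrier) ∧
        (∀ v : HexVertex, (δ : ℂ) * hexCenter v ∈ Metric.ball (D.pt 1) ρ →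
          (v ∈ Λ δ ↔ m δ ≤ v.1 1))) →
    (∀ K : Set ℂ, IsCompact K → K ⊆ D.carrier → ∀ᶠ δ : ℝ in nhdsWithin 0 (Set.Ioi 0),
      ∀ v : HexVertex, (δ : ℂ) * hexCenter v ∈ K → v ∈ Λ δ) →
    Filter.Tendsto (fun δ : ℝ => (δ : ℂ) * hexMidpoint (a δ)) (nhdsWithin 0 (Set.Ioi 0))
      (nhds (D.pt 0)) →
    Filter.Tendsto (fun δ : ℝ => (δ : ℂ) * hexMidpoint (b δ)) (nhdsWithin 0 (Set.Ioi 0))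
      (nhds (D.pt 1)) →
    ∀ K : Set ℂ, IsCompact K → K ⊆ D.carrier → ∃ C : ℝ,
      ∀ᶠ δ : ℝ in nhdsWithin 0 (Set.Ioi 0),
        δ ^ 2 * (∑ᶠ e ∈ {e : Sym2 HexVertex | e ∈ hexDomainMidEdges (Λ δ) ∧
            (δ : ℂ) * hexMidpoint e ∈ K},
            ‖hexParafermionicObservable (Λ δ) (a δ) hexCriticalFugacity (5 / 8) e‖) ≤
          C * δ ^ (-s) * ‖hexParafermionicObservable (Λ δ) (a δ) hexCriticalFugacity (5 / 8) (b δ)‖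

/-- `LocalL1BoundZ s`: the local `L¹` bound with power loss `δ^{-s}`, normalised by the boundary MASS
`Z_δ(b_δ) = ‖F_{x_c,0}(b_δ)‖` (stub 2 is `∀ s > 0, LocalL1BoundZ s`). Weaker than `LocalL1Bound s`
(`localL1BoundZ_of_localL1Bound`); it is all that `massRatioAt_of` uses. -/
def LocalL1BoundZ (s : ℝ) : Prop :=
  ∀ (D : DobrushinDomain) (ρ : ℝ) (Λ : ℝ → Finset HexVertex) (m : ℝ → ℤ)
    (a b : ℝ → Sym2 HexVertex),
    0 < ρ →
    D.carrier ∩ Metric.ball (D.pt 1) ρ = {z : ℂ | (D.pt 1).im < z.im} ∩ Metric.ball (D.pt 1) ρ →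
    (∀ᶠ δ : ℝ in nhdsWithin 0 (Set.Ioi 0),
      hexDomainSimplyConnected (Λ δ) ∧ a δ ∈ hexDomainBoundary (Λ δ) ∧
        b δ ∈ hexDomainBoundary (Λ δ) ∧ Nonempty (HexMidEdgeSAW (Λ δ) (a δ) (b δ)) ∧
        (hexGraph.induce ((Λ δ : Finset HexVertex) : Set HexVertex)).Preconnected ∧
        (∀ v ∈ Λ δ, (δ : ℂ) * hexCenter v ∈ D.carrier) ∧
        (∀ v : HexVertex, (δ : ℂ) * hexCenter v ∈ Metric.ball (D.pt 1) ρ →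
          (v ∈ Λ δ ↔ m δ ≤ v.1 1))) →
    (∀ K : Set ℂ, IsCompact K → K ⊆ D.carrier → ∀ᶠ δ : ℝ in nhdsWithin 0 (Set.Ioi 0),
      ∀ v : HexVertex, (δ : ℂ) * hexCenter v ∈ K → v ∈ Λ δ) →
    Filter.Tendsto (fun δ : ℝ => (δ : ℂ) * hexMidpoint (a δ)) (nhdsWithin 0 (Set.Ioi 0))
      (nhds (D.pt 0)) →
    Filter.Tendsto (fun δ : ℝ => (δ : ℂ) * hexMidpoint (b δ)) (nhdsWithin 0 (Set.Ioi 0))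
      (nhds (D.pt 1)) →
    ∀ K : Set ℂ, IsCompact K → K ⊆ D.carrier → ∃ C : ℝ,
      ∀ᶠ δ : ℝ in nhdsWithin 0 (Set.Ioi 0),
        δ ^ 2 * (∑ᶠ e ∈ {e : Sym2 HexVertex | e ∈ hexDomainMidEdges (Λ δ) ∧
            (δ : ℂ) * hexMidpoint e ∈ K},
            ‖hexParafermionicObservable (Λ δ) (a δ) hexCriticalFugacity (5 / 8) e‖) ≤
          C * δ ^ (-s) * ‖hexParafermionicObservable (Λ δ) (a δ) hexCriticalFugacity 0 (b δ)‖

/-- `|F_{x,σ}(b)| ≤ Z(b) = ‖F_{x,0}(b)‖` at any mid-edge (triangle inequality on the walk sum). -/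
theorem norm_obs_le_norm_obs_zero (Λ' : Finset HexVertex) (a' e : Sym2 HexVertex) (σ : ℝ) :
    ‖hexParafermionicObservable Λ' a' hexCriticalFugacity σ e‖ ≤
      ‖hexParafermionicObservable Λ' a' hexCriticalFugacity 0 e‖ := by
  have hx0 : 0 ≤ hexCriticalFugacity := hexCriticalFugacity_pos_lt_one.1.le
  calc ‖hexParafermionicObservable Λ' a' hexCriticalFugacity σ e‖
      ≤ ∑ γ : HexMidEdgeSAW Λ' a' e, hexCriticalFugacity ^ γ.length :=
        norm_hexParafermionicObservable_le _ _ hx0 _ _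
    _ = ‖hexParafermionicObservable Λ' a' hexCriticalFugacity 0 e‖ := by
        rw [hexParafermionicObservable_zero_spin, Complex.norm_real,
          Real.norm_of_nonneg (Finset.sum_nonneg fun γ _ => pow_nonneg hx0 _)]

/-- The round-1 normalisation implies the reshaped one: `LocalL1Bound s → LocalL1BoundZ s`. -/
theorem localL1BoundZ_of_localL1Bound {s : ℝ} (h : LocalL1Bound s) : LocalL1BoundZ s := by
  intro D ρ Λ m a b hρ hflat hadm hexh ha hb K hK hKD
  obtain ⟨C, hC⟩ := h D ρ Λ m a b hρ hflat hadm hexh ha hb K hK hKD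
  refine ⟨max C 0, ?_⟩
  filter_upwards [hC, self_mem_nhdsWithin] with δ hδ hδpos
  have hδ0 : 0 < δ := hδpos
  calc _ ≤ C * δ ^ (-s) *
          ‖hexParafermionicObservable (Λ δ) (a δ) hexCriticalFugacity (5 / 8) (b δ)‖ := hδ
    _ ≤ max C 0 * δ ^ (-s) *
          ‖hexParafermionicObservable (Λ δ) (a δ) hexCriticalFugacity (5 / 8) (b δ)‖ := by
        gcongr
        exact le_max_left _ _
    _ ≤ max C 0 * δ ^ (-s) *
          ‖hexParafermionicObservable (Λ δ) (a δ) hexCriticalFugacity 0 (b δ)‖ := by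
        gcongr
        exact norm_obs_le_norm_obs_zero _ _ _ _

/-- `MassRatioAt c`: the crux with exponent cut `c` (`MassRatio` is `MassRatioAt (3/4)` up to the
spelling `-(3:ℝ)/4 = -(3/4)` and its `let`). Stated for every `c` so that a planner re-cut of the
pair (`DefectDecoherence` at `θ > c`, `MassRatio` at `c`) re-uses the same two stubs with the budget
`θ' + s ≤ c`. -/
def MassRatioAt (c : ℝ) : Prop :=
  ∀ (D : DobrushinDomain) (ρ : ℝ) (Λ : ℝ → Finset HexVertex) (m : ℝ → ℤ)
    (a b : ℝ → Sym2 HexVertex),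
    0 < ρ →
    D.carrier ∩ Metric.ball (D.pt 1) ρ = {z : ℂ | (D.pt 1).im < z.im} ∩ Metric.ball (D.pt 1) ρ →
    (∀ᶠ δ : ℝ in nhdsWithin 0 (Set.Ioi 0),
      hexDomainSimplyConnected (Λ δ) ∧ a δ ∈ hexDomainBoundary (Λ δ) ∧
        b δ ∈ hexDomainBoundary (Λ δ) ∧ Nonempty (HexMidEdgeSAW (Λ δ) (a δ) (b δ)) ∧
        (hexGraph.induce ((Λ δ : Finset HexVertex) : Set HexVertex)).Preconnected ∧
        (∀ v ∈ Λ δ, (δ : ℂ) * hexCenter v ∈ D.carrier) ∧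
        (∀ v : HexVertex, (δ : ℂ) * hexCenter v ∈ Metric.ball (D.pt 1) ρ →
          (v ∈ Λ δ ↔ m δ ≤ v.1 1))) →
    (∀ K : Set ℂ, IsCompact K → K ⊆ D.carrier → ∀ᶠ δ : ℝ in nhdsWithin 0 (Set.Ioi 0),
      ∀ v : HexVertex, (δ : ℂ) * hexCenter v ∈ K → v ∈ Λ δ) →
    Filter.Tendsto (fun δ : ℝ => (δ : ℂ) * hexMidpoint (a δ)) (nhdsWithin 0 (Set.Ioi 0))
      (nhds (D.pt 0)) →
    Filter.Tendsto (fun δ : ℝ => (δ : ℂ) * hexMidpoint (b δ)) (nhdsWithin 0 (Set.Ioi 0))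
      (nhds (D.pt 1)) →
    ∀ K : Set ℂ, IsCompact K → K ⊆ D.carrier → ∃ C : ℝ,
      ∀ᶠ δ : ℝ in nhdsWithin 0 (Set.Ioi 0),
        δ ^ 2 * (∑ᶠ e ∈ {e : Sym2 HexVertex | e ∈ hexDomainMidEdges (Λ δ) ∧
            (δ : ℂ) * hexMidpoint e ∈ K},
            ‖hexParafermionicObservable (Λ δ) (a δ) hexCriticalFugacity 0 e‖) ≤
          C * δ ^ (-c) * ‖hexParafermionicObservable (Λ δ) (a δ) hexCriticalFugacity 0 (b δ)‖

/-! ## Lattice helpers (proved) -/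

/-- Adjacent faces of the honeycomb lattice have centres at distance `≤ 1` (exactly `1/√3`). -/
theorem norm_hexCenter_sub_le_one {v t : HexVertex} (h : hexGraph.Adj v t) :
    ‖hexCenter t - hexCenter v‖ ≤ 1 := by
  have key : ∀ (y z : Site 2), hexGraph.Adj (y, 0) (z, 1) →
      ‖hexCenter (z, 1) - hexCenter (y, 0)‖ ≤ 1 := by
    intro y z hyz
    have hsq : ‖hexCenter (z, 1) - hexCenter (y, 0)‖ ^ 2 ≤ 1 := by
      rw [Complex.sq_norm]
      have hdiff : hexCenter (z, 1) - hexCenter (y, 0) =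
          triEmbed z - triEmbed y + (1 + triZeta) / 3 := by
        simp only [hexCenter, Fin.val_zero, Fin.val_one, Nat.cast_zero, Nat.cast_one]
        ring
      rw [hdiff]
      rcases (hexGraph_adj_iff_of_snd_eq_zero_holds y z).1 hyz with h | h | h
      · rw [h]
        have : triEmbed y - triEmbed y + (1 + triZeta) / 3 =
            ((1 / 3 : ℝ) : ℂ) + ((1 / 3 : ℝ) : ℂ) * triZeta := by push_cast; ring
        rw [this, normSq_add_mul_triZeta]; norm_num
      · rw [h]
        have : triEmbed (y - Pi.single 0 1) - triEmbed y + (1 + triZeta) / 3 =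
            ((-2 / 3 : ℝ) : ℂ) + ((1 / 3 : ℝ) : ℂ) * triZeta := by
          rw [triEmbed_sub, triEmbed_single_zero]; push_cast; ring
        rw [this, normSq_add_mul_triZeta]; norm_num
      · rw [h]
        have : triEmbed (y - Pi.single 1 1) - triEmbed y + (1 + triZeta) / 3 =
            ((1 / 3 : ℝ) : ℂ) + ((-2 / 3 : ℝ) : ℂ) * triZeta := by
          rw [triEmbed_sub, triEmbed_single_one]; push_cast; ring
        rw [this, normSq_add_mul_triZeta]; norm_num
    nlinarith [norm_nonneg (hexCenter (z, 1) - hexCenter (y, 0))]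
  obtain ⟨y, i⟩ := v
  obtain ⟨z, j⟩ := t
  fin_cases i <;> fin_cases j
  · exact absurd h (not_hexGraph_adj_of_snd_eq_holds _ _ rfl)
  · exact key y z h
  · rw [norm_sub_rev]; exact key z y h.symm
  · exact absurd h (not_hexGraph_adj_of_snd_eq_holds _ _ rfl)

/-- Every face has finitely many (three) neighbours. -/
theorem finite_setOf_adj (v : HexVertex) : {t : HexVertex | hexGraph.Adj v t}.Finite := by
  obtain ⟨y, i⟩ := v
  fin_cases i
  · refine (Set.toFinite ({(y, 1), (y - Pi.single 0 1, 1), (y - Pi.single 1 1, 1)} :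
      Set HexVertex)).subset ?_
    rintro ⟨z, j⟩ ht
    fin_cases j
    · exact absurd ht (not_hexGraph_adj_of_snd_eq_holds _ _ rfl)
    · rcases (hexGraph_adj_iff_of_snd_eq_zero_holds y z).1 ht with rfl | rfl | rfl <;> simp
  · refine (Set.toFinite ({(y, 0), (y + Pi.single 0 1, 0), (y + Pi.single 1 1, 0)} :
      Set HexVertex)).subset ?_
    rintro ⟨z, j⟩ ht
    fin_cases j
    · rcases (hexGraph_adj_iff_of_snd_eq_zero_holds z y).1 ht.symm with rfl | rfl | rfl <;> simp
    · exact absurd ht (not_hexGraph_adj_of_snd_eq_holds _ _ rfl)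

/-- A finite vertex set has finitely many domain mid-edges. -/
theorem hexDomainMidEdges_finite (Λ : Finset HexVertex) : (hexDomainMidEdges Λ).Finite := by
  have h : hexDomainMidEdges Λ ⊆
      ⋃ v ∈ (Λ : Set HexVertex), (fun t => s(v, t)) '' {t : HexVertex | hexGraph.Adj v t} := by
    rintro e ⟨he, v, hve, hvΛ⟩
    refine Set.mem_biUnion hvΛ ⟨Sym2.Mem.other hve, ?_, Sym2.other_spec hve⟩
    have h' : s(v, Sym2.Mem.other hve) ∈ hexGraph.edgeSet := by rwa [Sym2.other_spec hve]
    exact (SimpleGraph.mem_edgeSet _).1 h'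
  exact ((Λ.finite_toSet).biUnion fun v _ => (finite_setOf_adj v).image _).subset h

/-! ## Glue (proved): the First lemma / Transfer at a general cut -/

/-- **First lemma of the card (Transfer `C⁺ ⟹ crux`), at a general cut.** If `θ' + s ≤ c` then
`SignalCoherenceL1 θ' → LocalL1Bound s → MassRatioAt c` (summed floor; the pointwise version is
`massRatioAt_of_pointwise`). -/
theorem massRatioAt_of {θ' s c : ℝ} (hcs : θ' + s ≤ c)
    (hSC : SignalCoherenceL1 θ') (hH : LocalL1BoundZ s) : MassRatioAt c := by
  intro D ρ Λ m a b hρ hflat hadm hexh ha hb K hK hKD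
  classical
  -- room around `K` inside `Ω`
  obtain ⟨d₀, hd₀, hd₀D⟩ := hK.exists_cthickening_subset_open D.isOpen hKD
  obtain ⟨d, hd, hdd⟩ : ∃ d : ℝ, 0 < d ∧ d + d = d₀ := ⟨d₀ / 2, by positivity, by ring⟩
  set K₁ : Set ℂ := Metric.cthickening d K with hK₁
  set K₂ : Set ℂ := Metric.cthickening d K₁ with hK₂
  have hK₁c : IsCompact K₁ := hK.cthickening
  have hK₂c : IsCompact K₂ := hK₁c.cthickening
  have hK₂D : K₂ ⊆ D.carrier := by
    refine ((Metric.cthickening_cthickening_subset hd.le hd.le K).trans ?_).trans hd₀D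
    rw [hdd]
  have hK₁K₂ : K₁ ⊆ K₂ := Metric.self_subset_cthickening K₁
  have hK₁D : K₁ ⊆ D.carrier := hK₁K₂.trans hK₂D
  -- the two stubs and the exhaustion clause, on `K₁` / `K₂`
  obtain ⟨c₀, hc₀, hfloor⟩ := hSC D ρ Λ m a b hρ hflat hadm hexh ha hb K₁ hK₁c hK₁D
  obtain ⟨C, hharn⟩ := hH D ρ Λ m a b hρ hflat hadm hexh ha hb K₂ hK₂c hK₂D
  have hex₂ := hexh K₂ hK₂c hK₂D
  have hsmall : ∀ᶠ δ : ℝ in nhdsWithin 0 (Set.Ioi 0), δ ∈ Set.Ioo 0 (min 1 d) :=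
    Ioo_mem_nhdsGT (lt_min one_pos hd)
  refine ⟨2 * c₀⁻¹ * max C 0, ?_⟩
  filter_upwards [hfloor, hharn, hex₂, hsmall] with δ hfl hha hex hδ
  obtain ⟨hδ0, hδ1⟩ := hδ
  have hδle1 : δ ≤ 1 := ((lt_min_iff.1 hδ1).1).le
  have hδd : δ ≤ d := ((lt_min_iff.1 hδ1).2).le
  -- notation
  set x : ℝ := hexCriticalFugacity with hx
  set F : Sym2 HexVertex → ℂ := hexParafermionicObservable (Λ δ) (a δ) x (5 / 8) with hF
  set Z : Sym2 HexVertex → ℂ := hexParafermionicObservable (Λ δ) (a δ) x 0 with hZ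
  set A : HexVertex → Finset HexVertex := fun v => (Λ δ).filter (fun t => hexGraph.Adj v t) with hA
  -- lattice geometry at mesh `δ`: an edge moves a point by at most `δ/2 ≤ d`
  have hclose : ∀ (v t : HexVertex), hexGraph.Adj v t →
      dist ((δ : ℂ) * hexMidpoint s(v, t)) ((δ : ℂ) * hexCenter v) ≤ d := by
    intro v t hvt
    rw [dist_eq_norm, hexMidpoint_mk]
    have : (δ : ℂ) * ((hexCenter v + hexCenter t) / 2) - (δ : ℂ) * hexCenter v =
        ((δ / 2 : ℝ) : ℂ) * (hexCenter t - hexCenter v) := by push_cast; ring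
    rw [this, norm_mul, Complex.norm_real, Real.norm_of_nonneg (by positivity)]
    calc δ / 2 * ‖hexCenter t - hexCenter v‖ ≤ δ / 2 * 1 := by
          gcongr; exact norm_hexCenter_sub_le_one hvt
      _ ≤ d := by linarith
  have hmid_of_center : ∀ {S : Set ℂ} (v t : HexVertex), hexGraph.Adj v t →
      (δ : ℂ) * hexCenter v ∈ S → (δ : ℂ) * hexMidpoint s(v, t) ∈ Metric.cthickening d S :=
    fun v t hvt hv => Metric.mem_cthickening_of_dist_le _ _ _ _ hv (hclose v t hvt)
  have hcenter_of_mid : ∀ {S : Set ℂ} (v t : HexVertex), hexGraph.Adj v t →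
      (δ : ℂ) * hexMidpoint s(v, t) ∈ S → (δ : ℂ) * hexCenter v ∈ Metric.cthickening d S :=
    fun v t hvt hv => Metric.mem_cthickening_of_dist_le _ _ _ _ hv
      (by rw [dist_comm]; exact hclose v t hvt)
  -- the finite index sets: stars `W`, star darts `P`, star edges `E`
  have hSfin := (finite_setOf_mem_center (Λ' := Λ δ) (δ := δ) (K := K₁))
  set W : Finset HexVertex := hSfin.toFinset with hW
  have hmemW : ∀ v : HexVertex, v ∈ W ↔ v ∈ Λ δ ∧ (δ : ℂ) * hexCenter v ∈ K₁ := fun v =>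
    hSfin.mem_toFinset
  set P : Finset (HexVertex × HexVertex) :=
    (W ×ˢ Λ δ).filter (fun p => hexGraph.Adj p.1 p.2) with hP
  set E : Finset (Sym2 HexVertex) := P.image (fun p => s(p.1, p.2)) with hE
  have hPsum : ∀ g : Sym2 HexVertex → ℝ,
      ∑ p ∈ P, g s(p.1, p.2) = ∑ v ∈ W, ∑ t ∈ A v, g s(v, t) := by
    intro g
    simp only [hP, hA, Finset.sum_filter, Finset.sum_product]
  -- the `K`-edges form a finite subset of `E`
  set M : Set (Sym2 HexVertex) :=
    {e : Sym2 HexVertex | e ∈ hexDomainMidEdges (Λ δ) ∧ (δ : ℂ) * hexMidpoint e ∈ K} with hM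
  have hMfin : M.Finite := (hexDomainMidEdges_finite (Λ δ)).subset fun e he => he.1
  have hMsub : hMfin.toFinset ⊆ E := by
    intro e
    induction e using Sym2.ind with
    | _ v t =>
      intro he
      rw [Set.Finite.mem_toFinset] at he
      obtain ⟨⟨hedge, -⟩, heK⟩ := he
      have hvt : hexGraph.Adj v t := (SimpleGraph.mem_edgeSet _).1 hedge
      have hvK₁ : (δ : ℂ) * hexCenter v ∈ K₁ := hcenter_of_mid v t hvt heK
      have htK₁ : (δ : ℂ) * hexCenter t ∈ K₁ :=
        hcenter_of_mid t v hvt.symm (by rw [Sym2.eq_swap]; exact heK)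
      have hvΛ : v ∈ Λ δ := hex v (hK₁K₂ hvK₁)
      have htΛ : t ∈ Λ δ := hex t (hK₁K₂ htK₁)
      refine Finset.mem_image.2 ⟨(v, t), ?_, rfl⟩
      exact Finset.mem_filter.2 ⟨Finset.mem_product.2 ⟨(hmemW v).2 ⟨hvΛ, hvK₁⟩, htΛ⟩, hvt⟩
  -- the star edges are domain mid-edges with midpoints in `K₂`
  set M₂ : Set (Sym2 HexVertex) :=
    {e : Sym2 HexVertex | e ∈ hexDomainMidEdges (Λ δ) ∧ (δ : ℂ) * hexMidpoint e ∈ K₂} with hM₂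
  have hM₂fin : M₂.Finite := (hexDomainMidEdges_finite (Λ δ)).subset fun e he => he.1
  have hEsub : E ⊆ hM₂fin.toFinset := by
    intro e he
    rw [Set.Finite.mem_toFinset]
    obtain ⟨p, hp, rfl⟩ := Finset.mem_image.1 he
    obtain ⟨hp1, hp2⟩ := Finset.mem_filter.1 hp
    obtain ⟨hpW, hpΛ⟩ := Finset.mem_product.1 hp1
    obtain ⟨hp1Λ, hp1K⟩ := (hmemW p.1).1 hpW
    exact ⟨⟨(SimpleGraph.mem_edgeSet _).2 hp2, p.1, Sym2.mem_mk_left _ _, hp1Λ⟩,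
      hmid_of_center p.1 p.2 hp2 hp1K⟩
  -- (1) bulk mass on `K` ≤ star masses
  have h1 : ∑ᶠ e ∈ M, ‖Z e‖ ≤ ∑ v ∈ W, ∑ t ∈ A v, ‖Z s(v, t)‖ := by
    rw [finsum_mem_eq_finite_toFinset_sum _ hMfin]
    calc ∑ e ∈ hMfin.toFinset, ‖Z e‖ ≤ ∑ e ∈ E, ‖Z e‖ :=
          Finset.sum_le_sum_of_subset_of_nonneg hMsub fun _ _ _ => norm_nonneg _
      _ ≤ ∑ p ∈ P, ‖Z s(p.1, p.2)‖ := Finset.sum_image_le_of_nonneg fun _ _ => norm_nonneg _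
      _ = ∑ v ∈ W, ∑ t ∈ A v, ‖Z s(v, t)‖ := hPsum fun e => ‖Z e‖
  -- (2) the summed floor over the `K₁`-stars
  have h2 : ∑ v ∈ W, ∑ t ∈ A v, ‖Z s(v, t)‖ ≤
      (c₀ * δ ^ θ')⁻¹ * ∑ v ∈ W, ∑ t ∈ A v, ‖F s(v, t)‖ := by
    have hpos : 0 < c₀ * δ ^ θ' := mul_pos hc₀ (Real.rpow_pos_of_pos hδ0 θ')
    rw [le_inv_mul_iff₀ hpos]
    have hfl' := hfl
    rw [finsum_center_eq_sum, finsum_center_eq_sum] at hfl'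
    exact hfl'.trans (Finset.sum_le_sum fun v _ => norm_sum_le _ _)
  -- (3) each star edge is counted at most twice
  have h3 : ∑ v ∈ W, ∑ t ∈ A v, ‖F s(v, t)‖ ≤ 2 * ∑ᶠ e ∈ M₂, ‖F e‖ := by
    rw [← hPsum fun e => ‖F e‖, finsum_mem_eq_finite_toFinset_sum _ hM₂fin]
    calc ∑ p ∈ P, ‖F s(p.1, p.2)‖
        = ∑ e ∈ E, (P.filter (fun p => s(p.1, p.2) = e)).card • ‖F e‖ :=
          Finset.sum_comp (fun e : Sym2 HexVertex => ‖F e‖) (fun p : HexVertex × HexVertex => s(p.1, p.2))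
      _ ≤ ∑ e ∈ E, 2 * ‖F e‖ := by
          refine Finset.sum_le_sum fun e he => ?_
          rw [nsmul_eq_mul]
          refine mul_le_mul_of_nonneg_right ?_ (norm_nonneg _)
          obtain ⟨p₀, -, rfl⟩ := Finset.mem_image.1 he
          have hcard : (P.filter (fun p => s(p.1, p.2) = s(p₀.1, p₀.2))).card ≤ 2 := by
            calc (P.filter (fun p => s(p.1, p.2) = s(p₀.1, p₀.2))).card
                ≤ ({p₀, (p₀.2, p₀.1)} : Finset (HexVertex × HexVertex)).card := by
                  refine Finset.card_le_card fun p hp => ?_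
                  have hpe := (Finset.mem_filter.1 hp).2
                  rw [Sym2.eq_iff] at hpe
                  rw [Finset.mem_insert, Finset.mem_singleton]
                  rcases hpe with ⟨h1', h2'⟩ | ⟨h1', h2'⟩
                  · exact Or.inl (Prod.ext h1' h2')
                  · exact Or.inr (Prod.ext h1' h2')
              _ ≤ 2 := Finset.card_le_two
          exact_mod_cast hcard
      _ = 2 * ∑ e ∈ E, ‖F e‖ := (Finset.mul_sum _ _ _).symm
      _ ≤ 2 * ∑ e ∈ hM₂fin.toFinset, ‖F e‖ :=
          mul_le_mul_of_nonneg_left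
            (Finset.sum_le_sum_of_subset_of_nonneg hEsub fun _ _ _ => norm_nonneg _) (by norm_num)
  -- (4) (reshaped: stub 2 is already normalised by `Z_δ(b_δ)`; nothing to do)
  -- (5) exponent budget
  have h5 : δ ^ (-θ') * δ ^ (-s) ≤ δ ^ (-c) := by
    rw [← Real.rpow_add hδ0]
    exact Real.rpow_le_rpow_of_exponent_ge hδ0 hδle1 (by linarith)
  have hinv : (c₀ * δ ^ θ')⁻¹ = c₀⁻¹ * δ ^ (-θ') := by
    rw [mul_inv, Real.rpow_neg hδ0.le]
  have hha' : δ ^ 2 * ∑ᶠ e ∈ M₂, ‖F e‖ ≤ max C 0 * δ ^ (-s) * ‖Z (b δ)‖ :=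
    hha.trans (by gcongr; exact le_max_left _ _)
  -- assemble
  calc δ ^ 2 * ∑ᶠ e ∈ M, ‖Z e‖
      ≤ δ ^ 2 * ((c₀ * δ ^ θ')⁻¹ * (2 * ∑ᶠ e ∈ M₂, ‖F e‖)) := by
        gcongr
        exact h1.trans (h2.trans (by gcongr))
    _ = 2 * c₀⁻¹ * δ ^ (-θ') * (δ ^ 2 * ∑ᶠ e ∈ M₂, ‖F e‖) := by rw [hinv]; ring
    _ ≤ 2 * c₀⁻¹ * δ ^ (-θ') * (max C 0 * δ ^ (-s) * ‖Z (b δ)‖) := by gcongr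
    _ = 2 * c₀⁻¹ * max C 0 * (δ ^ (-θ') * δ ^ (-s)) * ‖Z (b δ)‖ := by ring
    _ ≤ 2 * c₀⁻¹ * max C 0 * δ ^ (-c) * ‖Z (b δ)‖ := by gcongr

/-- The round-1 interface: the POINTWISE floor and the `L¹` bound give the crux at cut `c`. -/
theorem massRatioAt_of_pointwise {θ' s c : ℝ} (hcs : θ' + s ≤ c)
    (hSC : SignalCoherence θ') (hH : LocalL1Bound s) : MassRatioAt c :=
  massRatioAt_of hcs (signalCoherenceL1_of_pointwise hSC) (localL1BoundZ_of_localL1Bound hH)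

/-- The round-1 interface on the summed floor: `SignalCoherenceL1 θ'` and the `|F(b_δ)|`-normalised
`L¹` bound give the crux at cut `c`. -/
theorem massRatioAt_of_localL1Bound {θ' s c : ℝ} (hcs : θ' + s ≤ c)
    (hSC : SignalCoherenceL1 θ') (hH : LocalL1Bound s) : MassRatioAt c :=
  massRatioAt_of hcs hSC (localL1BoundZ_of_localL1Bound hH)

/-! ## How `DefectDecoherence` would enter stub 2 (proved): relative smallness of the defect -/

/-- `RelativeDefect η`: in the frame of `MassRatio`, at vertex stars deep in a compact `K` the
conjugate (spin `-11/8`) star defect `T(v) = Σ_{t ∼ v} conj(mid{v,t} − c_v) F_δ({v,t})` — the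
"missing half" of discrete Cauchy–Riemann, cf. `DefectDecoherence` — is `O(δ^η)` RELATIVE TO THE
`L¹` STAR MASS OF `F_δ` ITSELF (not of `Z_δ`). This is the form in which the route's crux #2 feeds any
interior-regularity mechanism for `stub_localL1Bound`: `F_δ` satisfies the vertex relation exactly and
its `∂̄`-source is relatively small in `L¹` on compacts (triage r1-1 (c): no hidden circularity). -/
def RelativeDefect (η : ℝ) : Prop :=
  ∀ (D : DobrushinDomain) (ρ : ℝ) (Λ : ℝ → Finset HexVertex) (m : ℝ → ℤ)
    (a b : ℝ → Sym2 HexVertex),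
    0 < ρ →
    D.carrier ∩ Metric.ball (D.pt 1) ρ = {z : ℂ | (D.pt 1).im < z.im} ∩ Metric.ball (D.pt 1) ρ →
    (∀ᶠ δ : ℝ in nhdsWithin 0 (Set.Ioi 0),
      hexDomainSimplyConnected (Λ δ) ∧ a δ ∈ hexDomainBoundary (Λ δ) ∧
        b δ ∈ hexDomainBoundary (Λ δ) ∧ Nonempty (HexMidEdgeSAW (Λ δ) (a δ) (b δ)) ∧
        (hexGraph.induce ((Λ δ : Finset HexVertex) : Set HexVertex)).Preconnected ∧
        (∀ v ∈ Λ δ, (δ : ℂ) * hexCenter v ∈ D.carrier) ∧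
        (∀ v : HexVertex, (δ : ℂ) * hexCenter v ∈ Metric.ball (D.pt 1) ρ →
          (v ∈ Λ δ ↔ m δ ≤ v.1 1))) →
    (∀ K : Set ℂ, IsCompact K → K ⊆ D.carrier → ∀ᶠ δ : ℝ in nhdsWithin 0 (Set.Ioi 0),
      ∀ v : HexVertex, (δ : ℂ) * hexCenter v ∈ K → v ∈ Λ δ) →
    Filter.Tendsto (fun δ : ℝ => (δ : ℂ) * hexMidpoint (a δ)) (nhdsWithin 0 (Set.Ioi 0))
      (nhds (D.pt 0)) →
    Filter.Tendsto (fun δ : ℝ => (δ : ℂ) * hexMidpoint (b δ)) (nhdsWithin 0 (Set.Ioi 0))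
      (nhds (D.pt 1)) →
    ∀ K : Set ℂ, IsCompact K → K ⊆ D.carrier → ∃ C : ℝ,
      ∀ᶠ δ : ℝ in nhdsWithin 0 (Set.Ioi 0), ∀ v : HexVertex, (δ : ℂ) * hexCenter v ∈ K →
        ‖∑ t ∈ (Λ δ).filter (fun t => hexGraph.Adj v t),
            (starRingEnd ℂ) (hexMidpoint s(v, t) - hexCenter v) *
              hexParafermionicObservable (Λ δ) (a δ) hexCriticalFugacity (5 / 8) s(v, t)‖ ≤
          C * δ ^ η * ∑ t ∈ (Λ δ).filter (fun t => hexGraph.Adj v t),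
            ‖hexParafermionicObservable (Λ δ) (a δ) hexCriticalFugacity (5 / 8) s(v, t)‖

/-- **`DefectDecoherence` + the floor ⟹ the defect is relatively small.** If the route's crux #2
holds with exponent `θ > 3/4` and the floor holds with `θ'`, then `RelativeDefect (θ − θ')`, and
`θ − θ' > 3/4 − θ' > 0` when `θ' < 3/4`: a `K`-deep star is `(d/δ)`-deep in `Λ_δ` by exhaustion,
`|T(v)| ≤ C (d/δ)^{-θ} Σ_t Z_δ(vt) ≤ C d^{-θ} c⁻¹ δ^{θ−θ'} |Σ_t F_δ(vt)| ≤ … Σ_t |F_δ(vt)|`. -/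
theorem relativeDefect_of_decoherence_of_floor {θ' : ℝ} (hDD : DefectDecoherence)
    (hSC : SignalCoherence θ') : ∃ η : ℝ, 3 / 4 - θ' < η ∧ RelativeDefect η := by
  obtain ⟨C, θ, hθ, hdd⟩ := hDD
  refine ⟨θ - θ', by linarith, ?_⟩
  intro D ρ Λ m a b hρ hflat hadm hexh ha hb K hK hKD
  obtain ⟨d, hd, hdD⟩ := hK.exists_cthickening_subset_open D.isOpen hKD
  have hK₁c : IsCompact (Metric.cthickening d K) := hK.cthickening
  obtain ⟨c₀, hc₀, hfloor⟩ := hSC D ρ Λ m a b hρ hflat hadm hexh ha hb K hK hKD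
  have hex₁ := hexh (Metric.cthickening d K) hK₁c hdD
  have hsmall : ∀ᶠ δ : ℝ in nhdsWithin 0 (Set.Ioi 0), δ ∈ Set.Ioo 0 (min 1 d) :=
    Ioo_mem_nhdsGT (lt_min one_pos hd)
  refine ⟨max C 0 * d ^ (-θ) * c₀⁻¹, ?_⟩
  filter_upwards [hadm, hfloor, hex₁, hsmall] with δ hadmδ hfl hex hδ
  obtain ⟨hδ0, hδ1⟩ := hδ
  have hδd : δ ≤ d := ((lt_min_iff.1 hδ1).2).le
  intro v hvK
  obtain ⟨hsc, haδ, -, -, -, -, -⟩ := hadmδ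
  obtain ⟨hedge, u, w, hauw, hwΛ, huΛ⟩ := haδ
  have huw : hexGraph.Adj u w := by
    rw [hauw] at hedge
    exact (SimpleGraph.mem_edgeSet _).1 hedge
  -- a `K`-deep star is `(d/δ)`-deep in `Λ_δ`
  have hR : 1 ≤ d / δ := by rw [le_div_iff₀ hδ0]; linarith
  have hdeep : ∀ y : HexVertex, dist (hexCenter y) (hexCenter v) ≤ d / δ → y ∈ Λ δ := by
    intro y hy
    refine hex y (Metric.mem_cthickening_of_dist_le _ _ _ _ hvK ?_)
    rw [dist_eq_norm] at hy ⊢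
    rw [← mul_sub, norm_mul, Complex.norm_real, Real.norm_of_nonneg hδ0.le]
    calc δ * ‖hexCenter y - hexCenter v‖ ≤ δ * (d / δ) := by gcongr
      _ = d := mul_div_cancel₀ _ hδ0.ne'
  have hDD' := hdd (Λ δ) hsc u w huw huΛ hwΛ v (d / δ) hR hdeep
  rw [← hauw] at hDD'
  -- the floor turns the `Z`-mass on the right into the `F`-mass
  have hpos : 0 < c₀ * δ ^ θ' := mul_pos hc₀ (Real.rpow_pos_of_pos hδ0 θ')
  have hZF : ∑ t ∈ (Λ δ).filter (fun t => hexGraph.Adj v t),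
      ‖hexParafermionicObservable (Λ δ) (a δ) hexCriticalFugacity 0 s(v, t)‖ ≤
      (c₀ * δ ^ θ')⁻¹ * ∑ t ∈ (Λ δ).filter (fun t => hexGraph.Adj v t),
        ‖hexParafermionicObservable (Λ δ) (a δ) hexCriticalFugacity (5 / 8) s(v, t)‖ := by
    rw [le_inv_mul_iff₀ hpos]
    exact (hfl v hvK).trans (norm_sum_le _ _)
  have halg : (d / δ) ^ (-θ) * (c₀ * δ ^ θ')⁻¹ = d ^ (-θ) * c₀⁻¹ * δ ^ (θ - θ') := by
    rw [Real.div_rpow hd.le hδ0.le, Real.rpow_sub hδ0, Real.rpow_neg hδ0.le, mul_inv]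
    have h1 : δ ^ θ ≠ 0 := (Real.rpow_pos_of_pos hδ0 θ).ne'
    have h2 : δ ^ θ' ≠ 0 := (Real.rpow_pos_of_pos hδ0 θ').ne'
    field_simp
  calc ‖∑ t ∈ (Λ δ).filter (fun t => hexGraph.Adj v t),
          (starRingEnd ℂ) (hexMidpoint s(v, t) - hexCenter v) *
            hexParafermionicObservable (Λ δ) (a δ) hexCriticalFugacity (5 / 8) s(v, t)‖
      ≤ C * (d / δ) ^ (-θ) * ∑ t ∈ (Λ δ).filter (fun t => hexGraph.Adj v t),
          ‖hexParafermionicObservable (Λ δ) (a δ) hexCriticalFugacity 0 s(v, t)‖ := hDD'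
    _ ≤ max C 0 * (d / δ) ^ (-θ) * ((c₀ * δ ^ θ')⁻¹ *
          ∑ t ∈ (Λ δ).filter (fun t => hexGraph.Adj v t),
            ‖hexParafermionicObservable (Λ δ) (a δ) hexCriticalFugacity (5 / 8) s(v, t)‖) := by
        gcongr
        exact le_max_left _ _
    _ = max C 0 * ((d / δ) ^ (-θ) * (c₀ * δ ^ θ')⁻¹) *
          ∑ t ∈ (Λ δ).filter (fun t => hexGraph.Adj v t),
            ‖hexParafermionicObservable (Λ δ) (a δ) hexCriticalFugacity (5 / 8) s(v, t)‖ := by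
        ring
    _ = max C 0 * d ^ (-θ) * c₀⁻¹ * δ ^ (θ - θ') *
          ∑ t ∈ (Λ δ).filter (fun t => hexGraph.Adj v t),
            ‖hexParafermionicObservable (Λ δ) (a δ) hexCriticalFugacity (5 / 8) s(v, t)‖ := by
        rw [halg]; ring

/-! ## Composition: the line concludes the crux by name -/

/-- **The line concludes the crux.** `MassRatio` from the two stubs: `θ' < 3/4` (stub 1) and the
`L¹` bound at `s := 3/4 − θ' > 0` (stub 2), through `massRatioAt_of` at the cut `3/4`. -/
theorem MassRatio_of : MassRatio := by
  obtain ⟨θ', hθ', hSC⟩ := stub_signalCoherenceL1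
  have hH : LocalL1BoundZ (3 / 4 - θ') := stub_localL1BoundZ (3 / 4 - θ') (by linarith)
  have h : MassRatioAt (3 / 4) := massRatioAt_of (by linarith) hSC hH
  intro D ρ Λ m a b Z hρ hflat hadm hexh ha hb K hK hKD
  obtain ⟨C, hC⟩ := h D ρ Λ m a b hρ hflat hadm hexh ha hb K hK hKD
  refine ⟨C, hC.mono fun δ hδ => ?_⟩
  rw [neg_div]
  exact hδ

end Summit.CriticalPhenomena.SAWScalingLimit.Cruxes.MassRatio.CoherenceFloorRhHarnack
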